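import Mathlib
import Summits.SmoothPoincare4.SmoothPoincare4.Theses.CylinderEntropy
import Literature.Geometry.Riemannian.LowEntropyHypersurfacesFour

/-!
# IdeateSketchK1 — crux `CylinderRungTwo` (stmt-SmoothPoincare4-7631), crux-ideate round 1, ideator 1 (published copy of the ideator folder Sketch.lean)

First lemmas of the idea cards `Ideas/killing-flux.md` and `Ideas/tilted-mean-convexity.md`,
typed over Mathlib + the route file.  Nothing here is proved except the sanity implication
`tiltedRung_of_crux` (the tilted rung is a special case of the crux).

Vocabulary (all concrete, in the coordinates of the route items): `N = {z ∈ ℝ⁶ | ∑_{i<5} zᵢ² = 1}`;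
`base z = (z₀,…,z₄,0)` is the unit normal of `N ⊂ ℝ⁶` at `z ∈ N`; `axis = e₅`; for a function
`f : ℝ⁶ → ℝ`, `gradN f` is the gradient tangential to `N`, `unitNormalN f = gradN f/‖gradN f‖` the unit
normal (inside `N`) of the level hypersurface `{f = 0} ∩ N` pointing into `{f > 0}`, `divN V` the
divergence along `N` of a vector field (`tr dV − ⟪dV base, base⟫`), and
`levelMeanCurvN f = divN (unitNormalN f)` the scalar mean curvature of the level hypersurface in `N`
(sum of the four principal curvatures w.r.t. `unitNormalN f`; slices `f = z₅ − a` have `0`; the value on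
the level set does not depend on the extension because `‖unitNormalN f‖ ≡ 1` near it).
-/

noncomputable section

namespace Summit.SmoothPoincare4.SmoothPoincare4.Cruxes.CylinderRungTwo.Sketch

open scoped BigOperators Topology Manifold Classical MeasureTheory RealInnerProductSpace ContDiff
open Filter Set Function TopologicalSpace MeasureTheory ContinuousMap

/-- `ℝ⁶`. -/
abbrev E6 := EuclideanSpace ℝ (Fin 6)
/-- `ℝ⁵`. -/
abbrev E5 := EuclideanSpace ℝ (Fin 5)

/-- The round cylinder `N = S⁴ × ℝ ⊂ ℝ⁶`. -/
def Ncyl : Set E6 := {z | ∑ i : Fin 5, z (Fin.castSucc i) ^ 2 = 1}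

/-- The vertical unit vector `e₅` (generator of the translation Killing field `∂_s`). -/
def axis : E6 := EuclideanSpace.single 5 1

/-- `(z₀,…,z₄,0)`: for `z ∈ N` the outward unit normal of `N ⊂ ℝ⁶`. -/
def base (z : E6) : E6 := z - (z 5) • axis

/-- Gradient of `f : ℝ⁶ → ℝ` made tangential to `N` (remove the `base` component). -/
def gradN (f : E6 → ℝ) (z : E6) : E6 := gradient f z - ⟪gradient f z, base z⟫ • base z

/-- Unit normal, inside `N`, of the level hypersurface `{f = 0} ∩ N`, pointing into `{f > 0}`
(junk `0` where `gradN f = 0`). -/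
def unitNormalN (f : E6 → ℝ) (z : E6) : E6 := ‖gradN f z‖⁻¹ • gradN f z

/-- Divergence along `N` of a vector field `V` on `ℝ⁶` tangent to `N`: trace of `dV` over `T_z N`. -/
def divN (V : E6 → E6) (z : E6) : ℝ :=
  LinearMap.trace ℝ E6 (fderiv ℝ V z).toLinearMap - ⟪fderiv ℝ V z (base z), base z⟫

/-- Scalar mean curvature (w.r.t. `unitNormalN f`, i.e. `div ν`) of the level hypersurface of `f` in `N`. -/
def levelMeanCurvN (f : E6 → ℝ) (z : E6) : ℝ := divN (unitNormalN f) z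

/-- `f` is a defining function of the cross-section `range ι` inside `N`, positive at the upper end:
smooth, `{f = 0} ∩ N = range ι`, non-degenerate along `range ι`, and `f > 0` high up in `N`. -/
def IsDefiningFunction {M : Type*} (ι : M → E6) (f : E6 → ℝ) : Prop :=
  ContDiff ℝ ∞ f ∧ (∀ z ∈ Ncyl, (f z = 0 ↔ z ∈ Set.range ι)) ∧ (∀ x, gradN f (ι x) ≠ 0) ∧
    ∃ R : ℝ, ∀ z ∈ Ncyl, R ≤ z 5 → 0 < f z

/-- Class `𝒞₊(c)`, "tilted mean convexity, cavity type": the region above `M` is strictly mean convex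
for the weight `e^{-c s}`, i.e. `H⃗ + c ∂_s^⊥` points up: `div_N ν < c ⟪e₅, ν⟫` along `M`. -/
def TiltedConvexUp {M : Type*} (ι : M → E6) (f : E6 → ℝ) (c : ℝ) : Prop :=
  ∀ x, levelMeanCurvN f (ι x) < c * ⟪axis, unitNormalN f (ι x)⟫

/-- Class `𝒞₋(c)`, "tilted mean convexity, mushroom type": the region below `M` is strictly mean
convex for the weight `e^{+c s}`: `div_N ν > -c ⟪e₅, ν⟫` along `M`. -/
def TiltedConvexDown {M : Type*} (ι : M → E6) (f : E6 → ℝ) (c : ℝ) : Prop :=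
  ∀ x, -(c * ⟪axis, unitNormalN f (ι x)⟫) < levelMeanCurvN f (ι x)

/-! ### Card `tilted-mean-convexity`: first lemma = the tilted rung (special case of the crux) -/

/-- **TiltedRung** (card `tilted-mean-convexity`, first checkable statement; a consequence of the crux
and the genericity-free sub-theorem the card proposes to prove first): a cross-section homotopy
4-sphere of `N` with cylinder entropy `< 4/e` which is tilted-mean-convex for some `c > 0` (either
class) is diffeomorphic to `S⁴`.  Hypotheses 1–5 are those of `CylinderRungTwo` verbatim. -/
def TiltedRung : Prop :=
  ∀ (M : Type) [TopologicalSpace M] [T2Space M] [SecondCountableTopology M]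
    [ChartedSpace (EuclideanSpace ℝ (Fin 4)) M] [IsManifold (𝓡 4) ∞ M],
    M ≃ₕ Metric.sphere (0 : EuclideanSpace ℝ (Fin 5)) 1 →
    ∀ ι : M → EuclideanSpace ℝ (Fin 6), Manifold.IsSmoothEmbedding (𝓡 4) (𝓡 6) ∞ ι →
    (∀ x, ∑ i : Fin 5, ι x (Fin.castSucc i) ^ 2 = 1) →
    (∃ R : ℝ, ∀ a b : EuclideanSpace ℝ (Fin 6), ∑ i : Fin 5, a (Fin.castSucc i) ^ 2 = 1 →
      ∑ i : Fin 5, b (Fin.castSucc i) ^ 2 = 1 → a 5 ≤ -R → R ≤ b 5 →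
      ¬ JoinedIn ({z : EuclideanSpace ℝ (Fin 6) | ∑ i : Fin 5, z (Fin.castSucc i) ^ 2 = 1} \ Set.range ι) a b) →
    (⨆ (p : EuclideanSpace ℝ (Fin 6)) (_ : ∑ i : Fin 5, p (Fin.castSucc i) ^ 2 = 1) (τ : ℝ) (_ : 0 < τ),
      (μH[4] (Metric.sphere (0 : EuclideanSpace ℝ (Fin 5)) 1))⁻¹ *
        ∫⁻ z in Set.range ι, ENNReal.ofReal ((∑' k : ℕ, Real.exp (-((k : ℝ) * ((k : ℝ) + 3)) * τ) *
          ((2 * (k : ℝ) + 3) / 3) * ∑ l ∈ Finset.range (k / 2 + 1), (-1 : ℝ) ^ l *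
          (∏ j ∈ Finset.range (k - l), ((3 : ℝ) / 2 + (j : ℝ))) /
          (((l.factorial : ℕ) : ℝ) * (((k - 2 * l).factorial : ℕ) : ℝ)) *
          (2 * ∑ i : Fin 5, z (Fin.castSucc i) * p (Fin.castSucc i)) ^ (k - 2 * l)) *
          Real.exp (-((z 5 - p 5) ^ 2) / (4 * τ))) ∂μH[4]) < ENNReal.ofReal (4 / Real.exp 1) →
    (∃ (f : E6 → ℝ) (c : ℝ), IsDefiningFunction ι f ∧ 0 < c ∧
      (TiltedConvexUp ι f c ∨ TiltedConvexDown ι f c)) →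
    Nonempty (M ≃ₘ⟮𝓡 4, 𝓡 4⟯ Metric.sphere (0 : EuclideanSpace ℝ (Fin 5)) 1)

/-- Sanity: the tilted rung is a special case of the crux (so it is TRUE if SPC4, like the crux). -/
theorem tiltedRung_of_crux (h : Theses.CylinderEntropy.CylinderRungTwo) : TiltedRung := by
  intro M _ _ _ _ _ e ι hι hN hsep hthin _
  exact h M e ι hι hN hsep hthin

/-! ### Card `killing-flux`: first lemma = the flux identity (degree formula for cross-sections) -/

/-- **FluxIdentity** (card `killing-flux`, first checkable statement): for every cross-section embedding
(hypotheses 2–4 of the crux, no homotopy or entropy hypothesis) and every defining function `f`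
positive at the upper end, the flux of the parallel field `e₅` through `M` equals the volume of the
unit `S⁴`:  `∫_M ⟪e₅, ν⟫ dμH⁴ = μH⁴(S⁴)`.  (Divergence theorem for `e₅` on the region of `N` between
`M` and a high slice; it is the static shadow of the conservation law `d/dt ∫_{M_t} ⟪e₅, ν⟫ = 0`
along mean curvature flow in `N`, and gives `AreaFloor` with rigidity since `⟪e₅, ν⟫ ≤ 1`.) -/
def FluxIdentity : Prop :=
  ∀ (M : Type) [TopologicalSpace M] [T2Space M] [SecondCountableTopology M]
    [ChartedSpace (EuclideanSpace ℝ (Fin 4)) M] [IsManifold (𝓡 4) ∞ M] [CompactSpace M]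
    (ι : M → EuclideanSpace ℝ (Fin 6)), Manifold.IsSmoothEmbedding (𝓡 4) (𝓡 6) ∞ ι →
    (∀ x, ∑ i : Fin 5, ι x (Fin.castSucc i) ^ 2 = 1) →
    (∃ R : ℝ, ∀ a b : EuclideanSpace ℝ (Fin 6), ∑ i : Fin 5, a (Fin.castSucc i) ^ 2 = 1 →
      ∑ i : Fin 5, b (Fin.castSucc i) ^ 2 = 1 → a 5 ≤ -R → R ≤ b 5 →
      ¬ JoinedIn ({z : EuclideanSpace ℝ (Fin 6) | ∑ i : Fin 5, z (Fin.castSucc i) ^ 2 = 1} \ Set.range ι) a b) →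
    ∀ f : E6 → ℝ, IsDefiningFunction ι f →
      ∫ z in Set.range ι, ⟪axis, unitNormalN f z⟫ ∂μH[4] =
        (μH[4] (Metric.sphere (0 : EuclideanSpace ℝ (Fin 5)) 1)).toReal

/-- **OnlySlicesAtTheFloor** (card `killing-flux`, rigidity companion of the route's `AreaFloor`):
a cross-section whose area equals `vol(S⁴)` is a slice `{z ∈ N | z₅ = a}`.  (`area − vol S⁴ =
∫_M (1 − ⟪e₅, ν⟫) ≥ 0` by `FluxIdentity`, with equality iff `ν ≡ e₅`, iff `M` is horizontal, iff a
slice.)  It is the `t → ∞` endpoint of the line: the immortal end-separating component has area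
decreasing to `vol(S⁴)`. -/
def OnlySlicesAtTheFloor : Prop :=
  ∀ (M : Type) [TopologicalSpace M] [T2Space M] [SecondCountableTopology M]
    [ChartedSpace (EuclideanSpace ℝ (Fin 4)) M] [IsManifold (𝓡 4) ∞ M] [CompactSpace M] [Nonempty M]
    (ι : M → EuclideanSpace ℝ (Fin 6)), Manifold.IsSmoothEmbedding (𝓡 4) (𝓡 6) ∞ ι →
    (∀ x, ∑ i : Fin 5, ι x (Fin.castSucc i) ^ 2 = 1) →
    (∃ R : ℝ, ∀ a b : EuclideanSpace ℝ (Fin 6), ∑ i : Fin 5, a (Fin.castSucc i) ^ 2 = 1 →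
      ∑ i : Fin 5, b (Fin.castSucc i) ^ 2 = 1 → a 5 ≤ -R → R ≤ b 5 →
      ¬ JoinedIn ({z : EuclideanSpace ℝ (Fin 6) | ∑ i : Fin 5, z (Fin.castSucc i) ^ 2 = 1} \ Set.range ι) a b) →
    μH[4] (Set.range ι) = μH[4] (Metric.sphere (0 : EuclideanSpace ℝ (Fin 5)) 1) →
    ∃ a : ℝ, Set.range ι = {z ∈ Ncyl | z 5 = a}

/-! ### Card `proxy-models-below-bubble-sheet`: first lemma = the Euclidean black box on the MODEL -/

/-- **CompactModelsAreSpheres** (card `proxy-models-below-bubble-sheet`, first checkable statement):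
the Euclidean theorem the line applies to a COMPACT blow-up model `Σ ⊂ T_x N = ℝ⁵` (never to `M`):
a closed, connected, simply connected embedded hypersurface of `ℝ⁵` with Gaussian entropy strictly below
`λ(S² × ℝ²) = 4/e` is diffeomorphic to `S⁴`.  It is the strict-inequality case of the tree fact
`ChodoshMantoulidisSchulze2025_lowEntropy_sphere_four` (b) (`cms_compactModels` below). -/
def CompactModelsAreSpheres : Prop :=
  ∀ (S : Type) [TopologicalSpace S] [T2Space S] [SecondCountableTopology S] [CompactSpace S]
    [ConnectedSpace S] [ChartedSpace (EuclideanSpace ℝ (Fin 4)) S] [IsManifold (𝓡 4) ∞ S],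
    SimplyConnectedSpace S → ∀ (j : S → EuclideanSpace ℝ (Fin 5)),
    Manifold.IsSmoothEmbedding (𝓡 4) (𝓡 5) ∞ j →
    Literature.Geometry.Riemannian.gaussianEntropy 4 (Set.range j) <
      Literature.Geometry.Riemannian.gaussianEntropy 4 (Literature.Geometry.Riemannian.shrinkingCylinder 4 2) →
    Nonempty (S ≃ₘ⟮𝓡 4, 𝓡 4⟯ Metric.sphere (0 : EuclideanSpace ℝ (Fin 5)) 1)

/-- The black box is already in the tree (as a named fact used as hypothesis). -/
theorem cms_compactModels
    (h : Literature.Geometry.Riemannian.ChodoshMantoulidisSchulze2025_lowEntropy_sphere_four) :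
    CompactModelsAreSpheres := by
  intro S _ _ _ _ _ _ _ hsc j hj hlt
  exact h.2 S hsc j hj hlt.le

end Summit.SmoothPoincare4.SmoothPoincare4.Cruxes.CylinderRungTwo.Sketch
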